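import Summits.Ventures.LatticeQCDFlow.TrivializingMaps.HaarByPartsZeroModes
import Summits.Ventures.LatticeQCDFlow.TrivializingMaps.WilsonPolynomials
import Summits.Ventures.LatticeQCDFlow.TrivializingMaps.FisherZeroNearCoupling

/-!
# SchwingerDysonIdentities — THE ENSEMBLE `π_β = 𝒵⁻¹e^{−βS}D[U]` OF A SMOOTH ACTION ON `SU(n)^E` AND THE
# ONE-DIRECTION SCHWINGER–DYSON / DIRICHLET IDENTITIES (theory2 item 127, PART 1 of 3: §0–§2)

HONEST FRAMING: exact (Metropolis-corrected) sampling algorithms for lattice gauge theory;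
figures of merit are autocorrelation/cost numbers at stated couplings and volumes; no
continuum-physics claim.

CUSTODY: theory2 item 127 (GEN-40, HOME tier) re-landed by lean-2 GEN-9 per LEAD LINE 245 RT-30 (202);
statements and proofs = HOME/lean/theory2/SchwingerDysonVarianceFloor.lean a9784aeca1b7b122 (853 l)
verbatim, split below the `lint.size` line into THREE files (`SchwingerDysonIdentities` §0–§2,
`SchwingerDysonField` §3, `SchwingerDysonVarianceFloor` §4); headers trimmed; docstrings added where the
lint asks.

Venture `LatticeQCDFlow` (cell pub-lqcd), theory-2 (FANOUT row 29), item 127 (v5.4).  This part: §0 two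
generic lemmas; §1 the ensemble `π_β` (`weight`, `gibbs`), its positivity / integrability; §2 for one
direction `Y ∈ 𝔰𝔲(n)` and one link `e`, Haar invariance (`∫ ∂ G D[U] = 0`, tree
`integral_linkDeriv_eq_zero`) applied to `G e^{−βS}` gives the Schwinger–Dyson identity
`∫ ∂G e^{−βS} = β ∫ G ∂S e^{−βS}` (`sd_identity`) and, applied once more, the one-direction Dirichlet
identity.  The family versions, the field `Φₑ = β|∇ₑS|² − ΔₑS` and the variance floor are PARTS 2–3.
-/

noncomputable section

set_option linter.unusedSectionVars false

namespace Summit.Ventures.LatticeQCDFlow.Theory2.SchwingerDyson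

open MeasureTheory ProbabilityTheory
open Literature.MathematicalPhysics.QuantumFieldTheory
open Literature.MathematicalPhysics.QuantumFieldTheory.Luscher2010
open Literature.MathematicalPhysics.QuantumFieldTheory.WilsonFlow (coeConfig continuous_coeConfig)
open Summit.Ventures.LatticeQCDFlow.TrivializingMaps
open scoped Matrix Matrix.Norms.Frobenius ContDiff

variable {d L n : ℕ} [NeZero L]

/-! ## §0. Two generic lemmas -/

section Generic

variable {Ω : Type*} [MeasurableSpace Ω]

/-- **Cauchy–Schwarz for real integrands** `(∫ f g)² ≤ (∫ f²)(∫ g²)` (via the discriminant of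
`t ↦ ∫ (t f − g)² ≥ 0`; same proof as the tree's `Exactness…sq_integral_mul_le`). [folklore] -/
theorem sq_integral_mul_le {μ : Measure Ω} {f g : Ω → ℝ} (hf2 : Integrable (fun x => f x ^ 2) μ)
    (hg2 : Integrable (fun x => g x ^ 2) μ) (hfg : Integrable (fun x => f x * g x) μ) :
    (∫ x, f x * g x ∂μ) ^ 2 ≤ (∫ x, f x ^ 2 ∂μ) * ∫ x, g x ^ 2 ∂μ := by
  set a := ∫ x, f x ^ 2 ∂μ with ha
  set b := ∫ x, f x * g x ∂μ with hb
  set c := ∫ x, g x ^ 2 ∂μ with hc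
  have hquad : ∀ t : ℝ, 0 ≤ a * (t * t) + (-2 * b) * t + c := by
    intro t
    have hnn : 0 ≤ ∫ x, (t * f x - g x) ^ 2 ∂μ := integral_nonneg fun x => sq_nonneg _
    have hexp : ∀ x, (t * f x - g x) ^ 2 = t ^ 2 * f x ^ 2 - 2 * t * (f x * g x) + g x ^ 2 :=
      fun x => by ring
    simp_rw [hexp] at hnn
    have hI1 : Integrable (fun x => t ^ 2 * f x ^ 2 - 2 * t * (f x * g x)) μ :=
      (hf2.const_mul _).sub (hfg.const_mul _)
    rw [integral_add hI1 hg2, integral_sub (hf2.const_mul _) (hfg.const_mul _), integral_const_mul,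
      integral_const_mul] at hnn
    rw [← ha, ← hb, ← hc] at hnn
    nlinarith [hnn]
  have hdisc := discrim_le_zero hquad
  rw [discrim] at hdisc
  nlinarith [hdisc]

/-- Integration against a tilted measure as a ratio of un-normalised integrals. [folklore] -/
theorem integral_tilted_eq_div (π : Measure Ω) (f g : Ω → ℝ) :
    ∫ x, g x ∂(π.tilted f) = (∫ x, g x * Real.exp (f x) ∂π) / ∫ x, Real.exp (f x) ∂π := by
  rw [integral_tilted, ← integral_div]
  refine integral_congr_ae (Filter.Eventually.of_forall fun x => ?_)
  show (Real.exp (f x) / ∫ x, Real.exp (f x) ∂π) • g x = g x * Real.exp (f x) / ∫ x, Real.exp (f x) ∂π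
  rw [smul_eq_mul]
  ring

/-- A bound on a bilinear–plus–linear double sum: if `|x_a| ≤ c₁`, `|D_ab| ≤ c₂`, `|T_ab| ≤ c₃`,
`0 ≤ β`, `0 ≤ c₂`, then `Σ_a x_a Σ_b (β(2 x_b D_ab) − T_ab) ≤ 2βc₂·k·Σ_a x_a² + k²c₁c₃`
(`k = #ι`; Cauchy–Schwarz `(Σ|x_a|)² ≤ k Σ x_a²`). [folklore] -/
theorem sum_mul_sum_le {ι : Type*} [Fintype ι] (x : ι → ℝ) (D T : ι → ι → ℝ)
    {β c₁ c₂ c₃ : ℝ} (hβ : 0 ≤ β) (hc₂ : 0 ≤ c₂) (h₁ : ∀ a, |x a| ≤ c₁)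
    (h₂ : ∀ a b, |D a b| ≤ c₂) (h₃ : ∀ a b, |T a b| ≤ c₃) :
    ∑ a, x a * ∑ b, (β * (2 * x b * D a b) - T a b) ≤
      2 * β * c₂ * Fintype.card ι * ∑ a, x a ^ 2 + (Fintype.card ι : ℝ) ^ 2 * (c₁ * c₃) := by
  have t : ∀ a b, x a * (β * (2 * x b * D a b) - T a b) ≤
      2 * β * c₂ * (|x a| * |x b|) + c₁ * c₃ := by
    intro a b
    have e1 : x a * x b * D a b ≤ |x a| * |x b| * c₂ :=
      calc x a * x b * D a b ≤ |x a * x b * D a b| := le_abs_self _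
        _ = |x a| * |x b| * |D a b| := by rw [abs_mul, abs_mul]
        _ ≤ |x a| * |x b| * c₂ := mul_le_mul_of_nonneg_left (h₂ a b) (by positivity)
    have e2 : -(x a * T a b) ≤ c₁ * c₃ :=
      calc -(x a * T a b) ≤ |x a * T a b| := neg_le_abs _
        _ = |x a| * |T a b| := abs_mul _ _
        _ ≤ c₁ * c₃ := mul_le_mul (h₁ a) (h₃ a b) (abs_nonneg _) ((abs_nonneg _).trans (h₁ a))
    have e3 : x a * (β * (2 * x b * D a b) - T a b) =
        2 * β * (x a * x b * D a b) + -(x a * T a b) := by ring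
    rw [e3]
    nlinarith [mul_nonneg (mul_nonneg (show (0:ℝ) ≤ 2 by norm_num) hβ) hc₂, e1, e2]
  have hcs : (∑ a, |x a|) ^ 2 ≤ Fintype.card ι * ∑ a, x a ^ 2 := by
    have h := sq_sum_le_card_mul_sum_sq (s := Finset.univ) (f := fun a => |x a|)
    simp only [sq_abs, Finset.card_univ] at h
    exact h
  calc ∑ a, x a * ∑ b, (β * (2 * x b * D a b) - T a b)
      = ∑ a, ∑ b, x a * (β * (2 * x b * D a b) - T a b) := by
        simp_rw [Finset.mul_sum]
    _ ≤ ∑ a, ∑ b, (2 * β * c₂ * (|x a| * |x b|) + c₁ * c₃) :=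
        Finset.sum_le_sum fun a _ => Finset.sum_le_sum fun b _ => t a b
    _ = 2 * β * c₂ * ((∑ a, |x a|) * ∑ b, |x b|) + Fintype.card ι * (Fintype.card ι * (c₁ * c₃)) := by
        rw [Finset.sum_mul_sum]
        simp only [Finset.sum_add_distrib, ← Finset.mul_sum, Finset.sum_const, Finset.card_univ,
          nsmul_eq_mul]
        ring
    _ ≤ 2 * β * c₂ * Fintype.card ι * ∑ a, x a ^ 2 + (Fintype.card ι : ℝ) ^ 2 * (c₁ * c₃) := by
        rw [← sq]
        nlinarith [mul_nonneg (mul_nonneg (show (0:ℝ) ≤ 2 by norm_num) hβ) hc₂, hcs]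

end Generic

/-! ## §1. The ensemble `π_β`, its weight, integrability -/

section Setting

/-- The un-normalised Boltzmann weight `w_β(U) = e^{β·(−S(U))}` of the ambient action `S`. -/
def weight (S : AmbConfig d L n → ℝ) (β : ℝ)
    (U : GaugeConfig d L (Matrix.specialUnitaryGroup (Fin n) ℂ)) : ℝ :=
  Real.exp (β * (-S (coeConfig U)))

/-- The ensemble `π_β = 𝒵⁻¹ e^{−β S(U)} D[U]` at coupling `β` (the measure item 125's `actionVar S β`
takes the variance of `S` against). -/
def gibbs (S : AmbConfig d L n → ℝ) (β : ℝ) :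
    Measure (GaugeConfig d L (Matrix.specialUnitaryGroup (Fin n) ℂ)) :=
  boltzmannMeasure fun U : GaugeConfig d L (Matrix.specialUnitaryGroup (Fin n) ℂ) =>
    β * S (coeConfig U)

variable {S : AmbConfig d L n → ℝ}

/-- The weight `e^{−βS}` is positive. [folklore] -/
theorem weight_pos (S : AmbConfig d L n → ℝ) (β : ℝ)
    (U : GaugeConfig d L (Matrix.specialUnitaryGroup (Fin n) ℂ)) : 0 < weight S β U :=
  Real.exp_pos _

/-- The weight is continuous. [folklore] -/
theorem continuous_weight (hS : ContDiff ℝ ∞ S) (β : ℝ) : Continuous (weight S β) := by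
  unfold weight
  exact (continuous_const.mul (continuous_comp_coeConfig hS).neg).rexp

/-- `π_β` is `D[U]` tilted by `β·(−S∘ι)` (tree `boltzmannMeasure_smul_eq_tilted`). -/
theorem gibbs_eq_tilted (hS : ContDiff ℝ ∞ S) (β : ℝ) :
    gibbs S β = (trivialMeasure (Matrix.specialUnitaryGroup (Fin n) ℂ) d L).tilted
      fun U => β * (-S (coeConfig U)) :=
  boltzmannMeasure_smul_eq_tilted hS β

/-- `π_β` is a probability measure. [folklore] -/
theorem isProbabilityMeasure_gibbs (hS : ContDiff ℝ ∞ S) (β : ℝ) :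
    IsProbabilityMeasure (gibbs S β) := by
  unfold gibbs
  exact isProbabilityMeasure_boltzmannMeasure (continuous_const.mul (continuous_comp_coeConfig hS))

/-- `D[U]` is a probability measure. [folklore] -/
theorem isProbabilityMeasure_trivialMeasure :
    IsProbabilityMeasure (trivialMeasure (Matrix.specialUnitaryGroup (Fin n) ℂ) d L) := by
  unfold trivialMeasure; infer_instance

/-- Continuous functions on the compact field manifold are integrable for every finite measure. -/
theorem integrable_of_continuous
    {ν : Measure (GaugeConfig d L (Matrix.specialUnitaryGroup (Fin n) ℂ))} [IsFiniteMeasure ν]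
    {f : GaugeConfig d L (Matrix.specialUnitaryGroup (Fin n) ℂ) → ℝ} (hf : Continuous f) :
    Integrable f ν := by
  haveI : SecondCountableTopology (Matrix (Fin n) (Fin n) ℂ) :=
    inferInstanceAs (SecondCountableTopology (Fin n → Fin n → ℂ))
  haveI : SecondCountableTopology (Matrix.specialUnitaryGroup (Fin n) ℂ) :=
    Topology.IsEmbedding.subtypeVal.secondCountableTopology
  exact (BoundedContinuousFunction.mkOfCompact ⟨f, hf⟩).integrable _

/-- `D[U]`-integrability of `F(ιU)·w_β(U)` for smooth `F`. -/
theorem integrable_mul_weight (hS : ContDiff ℝ ∞ S) (β : ℝ) {F : AmbConfig d L n → ℝ}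
    (hF : ContDiff ℝ ∞ F) :
    Integrable (fun U => F (coeConfig U) * weight S β U)
      (trivialMeasure (Matrix.specialUnitaryGroup (Fin n) ℂ) d L) :=
  integrable_trivialMeasure_of_continuous ((continuous_comp_coeConfig hF).mul (continuous_weight hS β))

/-- The partition integral `Z_β = ∫ w_β D[U]` is positive. -/
theorem integral_weight_pos (hS : ContDiff ℝ ∞ S) (β : ℝ) :
    0 < ∫ U, weight S β U ∂(trivialMeasure (Matrix.specialUnitaryGroup (Fin n) ℂ) d L) := by
  haveI := isProbabilityMeasure_trivialMeasure (d := d) (L := L) (n := n)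
  have hint : Integrable (weight S β) (trivialMeasure (Matrix.specialUnitaryGroup (Fin n) ℂ) d L) :=
    integrable_trivialMeasure_of_continuous (continuous_weight hS β)
  rw [integral_pos_iff_support_of_nonneg (fun U => (weight_pos S β U).le) hint]
  have hsupp : Function.support (weight S β) = Set.univ :=
    Set.eq_univ_of_forall fun U => (weight_pos S β U).ne'
  rw [hsupp, measure_univ]
  exact one_pos

end Setting

/-! ## §2. The Schwinger–Dyson and Dirichlet identities for one direction -/

section OneDirection

variable {S G : AmbConfig d L n → ℝ}

/-- `∂_{e,X} e^{β(−S)} = −β ∂_{e,X}S · e^{β(−S)}`. [folklore] -/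
theorem linkDeriv_exp_neg_mul (hS : ContDiff ℝ ∞ S) (β : ℝ) (e : Edge d L)
    (X : Matrix (Fin n) (Fin n) ℂ) (W : AmbConfig d L n) :
    linkDeriv e X (fun W' => Real.exp (β * (-S W'))) W =
      -(β * linkDeriv e X S W) * Real.exp (β * (-S W)) := by
  have hf : ContDiff ℝ ∞ fun W' => β * (-S W') := contDiff_const.mul hS.neg
  have h2 : linkDeriv e X (fun W' => β * (-S W')) W = -β * linkDeriv e X S W := by
    have : (fun W' => β * (-S W')) = fun W' => (-β) * S W' := by funext W'; ring
    rw [this, linkDeriv_const_mul']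
  rw [linkDeriv_scalar_comp (g := Real.exp) (f := fun W' => β * (-S W'))
      (Real.differentiable_exp _) (hf.differentiable (by simp) W) e X, Real.deriv_exp, h2]
  ring

/-- **Schwinger–Dyson identity** `∫ ∂_{e,X}G · e^{−βS} D[U] = β ∫ G ∂_{e,X}S · e^{−βS} D[U]`
(`X ∈ 𝔰𝔲(n)`; Haar invariance `∫ ∂(G e^{−βS}) = 0` plus Leibniz). [folklore] -/
theorem sd_identity (hS : ContDiff ℝ ∞ S) (hG : ContDiff ℝ ∞ G) (β : ℝ) (e : Edge d L)
    {X : Matrix (Fin n) (Fin n) ℂ} (hX : X ∈ suAlgebra n) :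
    ∫ U, linkDeriv e X G (coeConfig U) * weight S β U
        ∂(trivialMeasure (Matrix.specialUnitaryGroup (Fin n) ℂ) d L) =
      β * ∫ U, G (coeConfig U) * linkDeriv e X S (coeConfig U) * weight S β U
        ∂(trivialMeasure (Matrix.specialUnitaryGroup (Fin n) ℂ) d L) := by
  have hw : ContDiff ℝ ∞ fun W => Real.exp (β * (-S W)) := (contDiff_const.mul hS.neg).exp
  have h0 : ∫ U, linkDeriv e X (fun W => G W * Real.exp (β * (-S W))) (coeConfig U)
      ∂(trivialMeasure (Matrix.specialUnitaryGroup (Fin n) ℂ) d L) = 0 :=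
    integral_linkDeriv_eq_zero (hG.mul hw) e hX
  have hpt : (fun U : GaugeConfig d L (Matrix.specialUnitaryGroup (Fin n) ℂ) =>
      linkDeriv e X (fun W => G W * Real.exp (β * (-S W))) (coeConfig U)) =
      fun U => linkDeriv e X G (coeConfig U) * weight S β U -
        β * (G (coeConfig U) * linkDeriv e X S (coeConfig U) * weight S β U) := by
    funext U
    rw [linkDeriv_mul_of_differentiableAt e X (hG.differentiable (by simp) _)
        (hw.differentiable (by simp) _), linkDeriv_exp_neg_mul hS]
    unfold weight
    ring
  have I1 : Integrable (fun U => linkDeriv e X G (coeConfig U) * weight S β U)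
      (trivialMeasure (Matrix.specialUnitaryGroup (Fin n) ℂ) d L) :=
    integrable_mul_weight hS β (contDiff_linkDeriv hG e X)
  have I2 : Integrable (fun U => β * (G (coeConfig U) * linkDeriv e X S (coeConfig U) * weight S β U))
      (trivialMeasure (Matrix.specialUnitaryGroup (Fin n) ℂ) d L) :=
    (integrable_mul_weight hS β (hG.mul (contDiff_linkDeriv hS e X))).const_mul β
  rw [hpt, integral_sub I1 I2, integral_const_mul, sub_eq_zero] at h0
  exact h0

/-- **Dirichlet identity for one direction**:
`∫ G·(β(∂S)² − ∂∂S)·w = ∫ ∂G·∂S·w` (`∂ = ∂_{e,X}`, `w = e^{−βS}`; Schwinger–Dyson for `G ∂S`).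
[folklore] -/
theorem dirichlet_identity (hS : ContDiff ℝ ∞ S) (hG : ContDiff ℝ ∞ G) (β : ℝ) (e : Edge d L)
    {X : Matrix (Fin n) (Fin n) ℂ} (hX : X ∈ suAlgebra n) :
    ∫ U, G (coeConfig U) * (β * linkDeriv e X S (coeConfig U) ^ 2 -
        linkDeriv e X (linkDeriv e X S) (coeConfig U)) * weight S β U
        ∂(trivialMeasure (Matrix.specialUnitaryGroup (Fin n) ℂ) d L) =
      ∫ U, linkDeriv e X G (coeConfig U) * linkDeriv e X S (coeConfig U) * weight S β U
        ∂(trivialMeasure (Matrix.specialUnitaryGroup (Fin n) ℂ) d L) := by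
  have hS1 : ContDiff ℝ ∞ (linkDeriv e X S) := contDiff_linkDeriv hS e X
  have hS2 : ContDiff ℝ ∞ (linkDeriv e X (linkDeriv e X S)) := contDiff_linkDeriv hS1 e X
  have h : ∫ U, linkDeriv e X (fun W => G W * linkDeriv e X S W) (coeConfig U) * weight S β U
        ∂(trivialMeasure (Matrix.specialUnitaryGroup (Fin n) ℂ) d L) =
      β * ∫ U, G (coeConfig U) * linkDeriv e X S (coeConfig U) * linkDeriv e X S (coeConfig U) *
        weight S β U ∂(trivialMeasure (Matrix.specialUnitaryGroup (Fin n) ℂ) d L) :=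
    sd_identity hS (hG.mul hS1) β e hX
  have hpt : (fun U : GaugeConfig d L (Matrix.specialUnitaryGroup (Fin n) ℂ) =>
      linkDeriv e X (fun W => G W * linkDeriv e X S W) (coeConfig U) * weight S β U) =
      fun U => linkDeriv e X G (coeConfig U) * linkDeriv e X S (coeConfig U) * weight S β U +
        G (coeConfig U) * linkDeriv e X (linkDeriv e X S) (coeConfig U) * weight S β U := by
    funext U
    rw [linkDeriv_mul_of_differentiableAt e X (hG.differentiable (by simp) _)
        (hS1.differentiable (by simp) _)]
    ring
  have I3 : Integrable (fun U => linkDeriv e X G (coeConfig U) * linkDeriv e X S (coeConfig U) *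
      weight S β U) (trivialMeasure (Matrix.specialUnitaryGroup (Fin n) ℂ) d L) :=
    integrable_mul_weight hS β ((contDiff_linkDeriv hG e X).mul hS1)
  have I4 : Integrable (fun U => G (coeConfig U) * linkDeriv e X (linkDeriv e X S) (coeConfig U) *
      weight S β U) (trivialMeasure (Matrix.specialUnitaryGroup (Fin n) ℂ) d L) :=
    integrable_mul_weight hS β (hG.mul hS2)
  have I5 : Integrable (fun U => G (coeConfig U) * linkDeriv e X S (coeConfig U) *
      linkDeriv e X S (coeConfig U) * weight S β U)
      (trivialMeasure (Matrix.specialUnitaryGroup (Fin n) ℂ) d L) :=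
    integrable_mul_weight hS β ((hG.mul hS1).mul hS1)
  rw [hpt, integral_add I3 I4] at h
  have hgoal : (fun U : GaugeConfig d L (Matrix.specialUnitaryGroup (Fin n) ℂ) =>
      G (coeConfig U) * (β * linkDeriv e X S (coeConfig U) ^ 2 -
        linkDeriv e X (linkDeriv e X S) (coeConfig U)) * weight S β U) =
      fun U => β * (G (coeConfig U) * linkDeriv e X S (coeConfig U) *
        linkDeriv e X S (coeConfig U) * weight S β U) -
        G (coeConfig U) * linkDeriv e X (linkDeriv e X S) (coeConfig U) * weight S β U := by
    funext U; ring
  rw [hgoal, integral_sub (I5.const_mul β) I4, integral_const_mul]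
  linarith

end OneDirection

end Summit.Ventures.LatticeQCDFlow.Theory2.SchwingerDyson
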